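import Summits.HubbardSuperconductivity.HubbardSuperconductivity.Theorems.AnisotropyChordTransferFibre3RowCChi
import Summits.HubbardSuperconductivity.HubbardSuperconductivity.Theorems.AnisotropyChordTransferFibre3NC0Row
import Summits.HubbardSuperconductivity.HubbardSuperconductivity.Theorems.AnisotropyChordTransferFibre3RowCPsi
import Summits.HubbardSuperconductivity.HubbardSuperconductivity.Theorems.AnisotropyChordTransferFibre3RowCGradSup
import Summits.HubbardSuperconductivity.HubbardSuperconductivity.Theorems.AnisotropyChordTransferFibre3RowCNhi
import Summits.HubbardSuperconductivity.HubbardSuperconductivity.Theorems.AnisotropyChordTransferFibre3RowCTChi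
import Summits.HubbardSuperconductivity.HubbardSuperconductivity.Theorems.AnisotropyChordTransferFibre3RowCTGradSup

/-!
# Route `AnisotropyChord` / H0 rotor rung, row C (KT-2b) on the t-BLOCKS `64 ≤ L < 128`: block twin of `…AnisotropyChordTransferFibre3RowCNhi`

T-FORK (p1 g32, route-lead ruling R4-b; p2's inventory memo HOME/hubbard-h0-rotor-p2/TBLOCK-INVENTORY-g8.md §3–§4): the declarations of
`…RowCNhi` that carry the hypothesis `128 ≤ L` (or a constant that changes below `L = 128`, or the `L2.NamedCell` cell box) restated in the
namespace `RowC.T` with the SAME names for the t-blocks (route-lead ruling R1): analytic layer with `64 ≤ L` and the `L ≥ 64` numerics of p2 g8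
(`ManifoldA.nu_ceiling64` (ν < .0359), `manifold_band64`, `second_shell_window64` (±.0012/±.003), `RowC.fmax_uniform64`/`gmin_uniform64`
(same constant .07 + .1ν), `third_shell_window64` (±.0031/±.01), `window_k10_64` ([.24993, .25]), `lam_increment_bound64` (δ = .0022)); cell layer on
block cells `c : L2.TCell` (`cellFinalBoxCB (c.box a₁ a₂)`, `pmem_xTrueT`, `RowC.finalVec_mem_of_cellFinalBoxT`).  Declarations that do not change are NOT
duplicated (they resolve to `RowC`); proofs are verbatim up to the substitutions.
Prover seat `hubbard-h0-rotor-p1` g32 (route lead); helper for piece A = stmt-HubbardSuperconductivity-23918 of rung 19089 (`--supports`, helper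
class).  Nothing here proves superconductivity in the Hubbard model; lemmas for ONE row of ONE conditional reduction on the t-blocks; the rotor TARGET
as originally worded stays FALSE (g15 verdict).  Mathlib + the tree only; no sorry.
-/

set_option linter.dupNamespace false
set_option autoImplicit false

noncomputable section

open scoped BigOperators

namespace Summit.HubbardSuperconductivity.HubbardSuperconductivity.Theorems.AnisotropyChord.Transfer.Fibre3

namespace RowC

namespace T

variable (L : ℕ) [NeZero L]

/-- `δ = η + 0.0022c_s` (`GradSupBound`). -/
def delN (t ν a : ℝ) : ℝ := etaN ν + 0.0022 * csN t ν a


/-- the bulk `(17f_nn²δ² + 8ξ²M² + 16ζ²M²)·τ̄`. -/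
def bulkN (t ν a x4 k11 k20 : ℝ) : ℝ :=
  (17 * fnnN ν a ^ 2 * delN t ν a ^ 2 + 8 * xiN t ν a k20 ^ 2 * MN t ν a ^ 2 + 16 * zeN t ν a k11 ^ 2 * MN t ν a ^ 2)
    * tauN t ν a x4


/-- ★ `Nhi`, normalised: `(9/4)M²Ψ⁺ + 12(zw + bulk)`. -/
def NhiN (t ν a x4 k11 k20 zw : ℝ) : ℝ := 9 / 4 * MN t ν a ^ 2 * PsiN t ν a x4 k11 k20 + 12 * (zw + bulkN t ν a x4 k11 k20)


section ingredients

variable {L}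

/-- `τ̄ = ‖∇ₓs‖² = tauN`. [folklore] -/
theorem gradNormSq_eq_tauN (hL : 64 ≤ L) {Δ lam2 : ℝ} {f : Tor L → ℝ} (hΔ0 : 0 ≤ Δ) (hΔ1 : Δ < 1) (hf : IsGroundTwoMagnon L Δ lam2 f) :
    gradNormSq L Δ f = tauN ((2 * Real.pi / L) ^ 2) (lam2 / (2 * Real.pi / L) ^ 2) (Δ * f (K1 L))
      (((2 * Real.pi / L) ^ 2) ^ 2 * S2n L lam2) := by
  have hL3 : 3 ≤ L := by omega
  have h := Rbar_eq_RbN hL hΔ0 hΔ1 hf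
  rw [rbarClosed_holds L Δ lam2 f hL3 hf] at h
  obtain ⟨hη, _, _, _⟩ := dict_N hL hΔ0 hΔ1 hf
  unfold RbN at h
  rw [hη] at h
  linarith


/-- `a_λ(x̂) = k10N t a`. [folklore] -/
theorem aKer_ex_eq_k10N (hL : 64 ≤ L) {Δ lam2 : ℝ} {f : Tor L → ℝ} (hΔ0 : 0 ≤ Δ) (hΔ1 : Δ < 1) (hf : IsGroundTwoMagnon L Δ lam2 f) : aKer L lam2 (ex L) = k10N ((2 * Real.pi / L) ^ 2) (Δ * f (K1 L)) := by
  have hL5 : 5 ≤ L := by omega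
  have hL0 : (0 : ℝ) < L := by exact_mod_cast (show 0 < L by omega)
  have hπ := Real.pi_pos
  obtain ⟨_, _, _, hV⟩ := dict_N hL hΔ0 hΔ1 hf
  obtain ⟨hax, _⟩ := ManifoldA.axis_window_closed L hL5 hΔ0 hΔ1 hf
  rw [hax (ex L) (ex_mem_nnList L)]
  unfold k10N
  have ha0 : 0 ≤ Δ * f (K1 L) := mul_nonneg hΔ0 hf.1.2.2.1.le
  have hVpos : (0 : ℝ) < (L : ℝ) ^ 2 := by positivity
  have ht0 : 0 < (2 * Real.pi / L) ^ 2 := by positivity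
  rw [hV]
  field_simp


/-- the window values through `a_λ`: `ξ = xiN`, `ζ = zeN`. [folklore] -/
theorem xiW_zetaW_eq (hL : 64 ≤ L) {Δ lam2 : ℝ} {f : Tor L → ℝ} (hΔ0 : 0 ≤ Δ) (hΔ1 : Δ < 1) (hf : IsGroundTwoMagnon L Δ lam2 f) :
    xiW L f = xiN ((2 * Real.pi / L) ^ 2) (lam2 / (2 * Real.pi / L) ^ 2) (Δ * f (K1 L)) (aKer L lam2 (ex L + ex L)) ∧
    zetaW L f = zeN ((2 * Real.pi / L) ^ 2) (lam2 / (2 * Real.pi / L) ^ 2) (Δ * f (K1 L)) (aKer L lam2 (ex L + ey L)) := by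
  have hL5 : 5 ≤ L := by omega
  have hL3 : 3 ≤ L := by omega
  obtain ⟨_, hcs, _, _⟩ := dict_N hL hΔ0 hΔ1 hf
  obtain ⟨_, hwin⟩ := ManifoldA.axis_window_closed L hL5 hΔ0 hΔ1 hf
  have hk10 := aKer_ex_eq_k10N hL hΔ0 hΔ1 hf
  have hx0 : ex L ≠ 0 := by rw [← K1_eq_ex]; exact K1_ne_zero L (by omega)
  have hxx0 : ex L + ex L ≠ 0 := two_ex_ne_zero L hL3
  have hxy0 : ex L + ey L ≠ 0 := ex_add_ey_ne_zero L (by omega)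
  have e1 := hwin (ex L) hx0
  have e2 := hwin (ex L + ex L) hxx0
  have e3 := hwin (ex L + ey L) hxy0
  unfold xiW zetaW xiN zeN
  rw [← hcs, ← hk10]
  constructor <;> linarith


/-- `‖T₀s‖² = lapN`. [folklore] -/
theorem lapNormSq_eq_lapN (hL : 64 ≤ L) {Δ lam2 : ℝ} {f : Tor L → ℝ} (hΔ0 : 0 ≤ Δ) (hΔ1 : Δ < 1) (hf : IsGroundTwoMagnon L Δ lam2 f) :
    lapNormSq L Δ f = lapN ((2 * Real.pi / L) ^ 2) (lam2 / (2 * Real.pi / L) ^ 2) (Δ * f (K1 L))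
      (((2 * Real.pi / L) ^ 2) ^ 2 * S2n L lam2) := by
  classical
  have hL5 : 5 ≤ L := by omega
  have hL3 : 3 ≤ L := by omega
  have hL0 : (0 : ℝ) < L := by exact_mod_cast (show 0 < L by omega)
  have hπ := Real.pi_pos
  have ht0 : 0 < (2 * Real.pi / L) ^ 2 := by positivity
  obtain ⟨_, hcs, _, hV⟩ := dict_N hL hΔ0 hΔ1 hf
  have hlam0 : 0 < lam2 := lam2_pos L hL3 hΔ1 hf.1
  have hlap := lapNormNamed_holds L Δ lam2 f hL5 hΔ0 hΔ1 hf
  have hgap := gapEquationS1_holds L hL5 hΔ0 hΔ1 lam2 f hf hlam0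
  unfold aPar at hgap
  -- expand the sum over `k ≠ 0`
  have hg0 : gres L lam2 0 = 0 := by unfold gres; simp
  have hS1 : ∑ k ∈ (Finset.univ : Finset (Tor L)).erase 0, gres L lam2 k = S1n L lam2 := by
    rw [S1n_eq, ← Finset.sum_erase_add _ _ (Finset.mem_univ (0 : Tor L)), hg0, add_zero]
  have hS2 : ∑ k ∈ (Finset.univ : Finset (Tor L)).erase 0, gres L lam2 k ^ 2 = S2n L lam2 := by
    rw [S2n_eq, ← Finset.sum_erase_add _ _ (Finset.mem_univ (0 : Tor L)), hg0]; ring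
  have hcard : (((Finset.univ : Finset (Tor L)).erase 0).card : ℝ) = (L : ℝ) ^ 2 - 1 := by
    rw [Finset.card_erase_of_mem (Finset.mem_univ _), Finset.card_univ]
    have : Fintype.card (Tor L) = L * L := by simp [ZMod.card]
    rw [this]
    have hL1 : 1 ≤ L * L := Nat.one_le_iff_ne_zero.mpr (by positivity)
    push_cast [Nat.cast_sub hL1]
    ring
  have hsum : ∑ k ∈ (Finset.univ : Finset (Tor L)).erase 0, (1 + lam2 * gres L lam2 k) ^ 2
      = ((L : ℝ) ^ 2 - 1) + 2 * lam2 * S1n L lam2 + lam2 ^ 2 * S2n L lam2 := by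
    have e : ∀ k : Tor L, (1 + lam2 * gres L lam2 k) ^ 2 = 1 + 2 * lam2 * gres L lam2 k + lam2 ^ 2 * gres L lam2 k ^ 2 := by
      intro k; ring
    simp only [e, Finset.sum_add_distrib, Finset.sum_const, nsmul_eq_mul, mul_one, ← Finset.mul_sum, hS1, hS2, hcard]
  rw [hlap, hsum]
  -- `c_s S₁ = V − a(V − 1)`, `c_s > 0`
  have hcpos : 0 < cS L Δ lam2 f := by
    unfold cS
    have hf1 : 0 < f (K1 L) := hf.1.2.2.1
    have : 0 < 4 * (1 - Δ) + Δ * lam2 := by nlinarith [mul_nonneg hΔ0 hlam0.le]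
    exact mul_pos hf1 this
  have hS1v : S1n L lam2 = ((L : ℝ) ^ 2 - Δ * f (K1 L) * ((L : ℝ) ^ 2 - 1)) / cS L Δ lam2 f := by
    rw [eq_div_iff hcpos.ne', mul_comm]; exact hgap
  rw [hS1v]
  unfold lapN
  rw [← hcs]
  set c := cS L Δ lam2 f with hcdef
  have hc0 : c ≠ 0 := hcpos.ne'
  rw [hV]
  field_simp
  ring


end ingredients


/-- ★★ **THE `‖C0′‖²` INPUT IN NORMALISED CLOSED FORM** (`L ≥ 128`, ground profile, `0 ≤ Δ < 1`, `Σ_{shellWin} C0² ≤ zw`). [folklore] -/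
theorem nC0p_le_NhiN (hL : 64 ≤ L) {Δ lam2 : ℝ} {f : Tor L → ℝ} (hΔ0 : 0 ≤ Δ) (hΔ1 : Δ < 1)
    (hf : IsGroundTwoMagnon L Δ lam2 f) (zw : ℝ)
    (hzw : (∑ b ∈ shellWin L, C0fn L Δ lam2 f (ex L, b) ^ 2) ≤ zw) :
    nC0p L Δ f ≤ NhiN ((2 * Real.pi / L) ^ 2) (lam2 / (2 * Real.pi / L) ^ 2) (Δ * f (K1 L))
      (((2 * Real.pi / L) ^ 2) ^ 2 * S2n L lam2) (aKer L lam2 (ex L + ey L)) (aKer L lam2 (ex L + ex L)) zw := by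
  have hL5 : 5 ≤ L := by omega
  have hL3 : 3 ≤ L := by omega
  have hL2 : 2 ≤ L := by omega
  have hL0 : (0 : ℝ) < L := by exact_mod_cast (show 0 < L by omega)
  have hπ := Real.pi_pos
  set t : ℝ := (2 * Real.pi / L) ^ 2 with ht
  have ht0 : 0 < t := by positivity
  set ν : ℝ := lam2 / t with hν
  set a : ℝ := Δ * f (K1 L) with ha
  set x4 : ℝ := t ^ 2 * S2n L lam2 with hx4
  set k11 : ℝ := aKer L lam2 (ex L + ey L) with hk11
  set k20 : ℝ := aKer L lam2 (ex L + ex L) with hk20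
  obtain ⟨hη, hcs, hfnn, hV⟩ := dict_N hL hΔ0 hΔ1 hf
  rw [← ht, ← hν] at hη
  rw [← ht, ← hν, ← ha] at hcs hfnn
  have hνle : lam2 ≤ 0.0513 * (2 * Real.pi / L) ^ 2 := by
    have h := ManifoldA.nu_ceiling64 L hL hΔ0 hf
    rw [← ht] at h ⊢
    have : 0.0359 * t ≤ 0.0513 * t := by nlinarith [ht0.le]
    linarith
  have hswap : ∀ r : Tor L, f (r.2, r.1) = f r := ground_swap L hL2 hf
  have hmirror : ∀ r : Tor L, f (-r.1, r.2) = f r := ground_mirror L hL2 hf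
  have hM := abs_f_le_MN hL hΔ0 hΔ1 hf
  rw [← ht, ← hν, ← ha] at hM
  -- `δ = η + 0.0022 c_s`
  have hδ : ∀ e ∈ nnList L, ∀ b : Tor L, b ≠ 0 → b - e ≠ 0 → |Dgrad L f e b| ≤ delN t ν a := by
    intro e he b hb hbe
    have h := grad_sup_bound L hL hΔ0 hΔ1 hf hνle he hb hbe
    unfold delN; rw [← hη, ← hcs]; exact h
  have hδ0 : 0 ≤ delN t ν a := by
    have := hδ (ex L) (ex_mem_nnList L) (ex L + ex L) (two_ex_ne_zero L hL3) (by rw [add_sub_cancel_right, ← K1_eq_ex]; exact K1_ne_zero L hL2)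
    exact le_trans (abs_nonneg _) this
  -- `NC0Row`
  have hrow := nC0Row_holds L hL3 Δ lam2 (MN t ν a) (delN t ν a) f hf hswap hmirror hM hδ hδ0
  -- `Ψ` semi-closed
  obtain ⟨_, _, _, _, _, hpsi⟩ := psiSemiClosed_holds L Δ lam2 f hL5 hΔ0 hΔ1 hf
  -- substitutions
  have hτ := gradNormSq_eq_tauN hL hΔ0 hΔ1 hf
  obtain ⟨hxi, hze⟩ := xiW_zetaW_eq hL hΔ0 hΔ1 hf
  have hlap := lapNormSq_eq_lapN hL hΔ0 hΔ1 hf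
  rw [← ht, ← hν, ← ha, ← hx4] at hτ hlap
  rw [← ht, ← hν, ← ha, ← hk20] at hxi
  rw [← ht, ← hν, ← ha, ← hk11] at hze
  have hkap : kapW L lam2 f = kapN t ν a k11 k20 := by unfold kapW kapN; rw [hη, hxi, hze]
  have hcr : crossW L lam2 f = crN t ν a k11 k20 := by unfold crossW crN; rw [hη, hxi, hze]
  have hPsi : PsiSum L Δ f ≤ PsiN t ν a x4 k11 k20 := by
    unfold PsiN; rw [← hτ, ← hkap, ← hcr, ← hlap]; exact hpsi
  have hM2 : 0 ≤ 9 / 4 * MN t ν a ^ 2 := by positivity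
  have hbulk : (17 * f (ex L) ^ 2 * delN t ν a ^ 2 + 8 * xiW L f ^ 2 * MN t ν a ^ 2 + 16 * zetaW L f ^ 2 * MN t ν a ^ 2)
      * gradNormSq L Δ f = bulkN t ν a x4 k11 k20 := by
    unfold bulkN; rw [← K1_eq_ex, hfnn, hxi, hze, hτ]
  unfold NhiN
  rw [← hbulk]
  have := mul_le_mul_of_nonneg_left hPsi hM2
  linarith [hrow]


end T

end RowC

end Summit.HubbardSuperconductivity.HubbardSuperconductivity.Theorems.AnisotropyChord.Transfer.Fibre3

end
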